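import Summits.QuantumFields.YangMills.Theorems.BalabanUVNodesN12FlatLinFamilyRightInverseUniform
import Summits.QuantumFields.YangMills.Theorems.BalabanUVNodesN12FlatLinAvgLetterFloor
import HarnessLib

/-!
# BalabanUVNodes ∕ N12 — (J-b) module H13c: THE LETTER OF module H13 IS ORDER-SHARP IN `M = L^k` — every right inverse of the true `k`-fold linearisation `Q^{(k)} = M•Q_k − dΛ_k` costs at least
# `M^{d−2}` on the unit datum of one direction: `Q k Y = 𝟙_{dir = μ₀}·E₀ ⟹ M^d·|T^{(k)}| ≤ M²·Σ_b ‖Y(b)‖²` (`E₀` a matrix unit, `Σ_c ‖v(c)‖² = |T^{(k)}|`), i.e. `Σ‖Y‖² ≥ M^{d−2}·Σ‖v‖²`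

Cell `pub-ymgap` (HUMAN RULINGS D-0062 ∕ D-0149), width seat `pub-ymgap-dag-n10-w1` g5 (modules H8–H13 of this session; rung R6♭ of HOME `pub-ymgap-dag-n10-w1/EXIT-B-LADDER-g5.md`).
`--kind proof --supports stmt-QuantumFields-27364 --as helper` (K1⁹, KEY MAP v2); count-neutral; THEOREMS ONLY (0 `def`, 0 `sorry`, 0 `instance`, 0 `notation`).

THE PAIRING (module H12c one bookkeeping level up).  Test against the indicator `w = 𝟙_{dir = μ₀}` of the coarse `μ₀`-bonds in the real `(i₀,i₀)`-component: by UST's `linFamily_eq_sub_comb`,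
`Σ_c w(c)·re(Q k Y(c))_{i₀i₀} = M·Σ_c w(c)·Q_k(re Y_{i₀i₀})(c) − Σ_c w(c)·(re Λ_k(c₊)_{i₀i₀} − re Λ_k(c₋)_{i₀i₀})`; the comb term telescopes to `0` along each `μ₀`-line of the coarse torus
(module H12c's `sum_indicator_grad_eq_zero`), and `Σ_c w(c)·(Q_kX)(c) = Σ_b (Q_kᵗw)(b)·X(b)` with the `k`-fold tent kernel of module H9 giving `(Q_kᵗw)(b) = M^{−d}·𝟙_{dir b = μ₀}` (both end weights
`(o+1)`, `(M−1−o)` of the tent see the same value `1`).  Hence for `Q k Y = w·E₀`: `|T^{(k)}| = M^{1−d}·Σ_{dir b = μ₀} re Y(b)_{i₀i₀} ≤ M^{1−d}·√(M^d|T^{(k)}|)·√(Σ_b‖Y b‖²)` (Cauchy–Schwarz over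
the `M^d|T^{(k)}|` fine `μ₀`-bonds), i.e. `M^d·|T^{(k)}| ≤ M²·Σ_b‖Y b‖²`.  So module H13's `|n|(6M^d∕(M²+2) + 1152d(d+2)²)` is of the right order `M^{d−2}` (η-units `Θ(1)`, uniformly in `k`), as
print's (46) asserts for the k-fold operation (44).

CONTENTS (ns `Summit.QuantumFields.YangMills.BalabanUVNodes.N12FlatLinFamilyLetterFloor`).  §1 `sum_kernel_iter_indicator_dir` (`Q_kᵗ𝟙_{μ₀} = M^{−d}𝟙_{μ₀}`), `card_site_zero_eq_mul`
(`|T^{(0)}| = M^d·|T^{(k)}|`).  §2 ★★★ `letter_floor_linFamily_dir`, ★★ `letter_floor_linFamily_rightInverse` (every right inverse `R` of `Q k`: `M^d·Σ‖v₀‖² ≤ M²·Σ‖R v₀‖²` at the datum `v₀`).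

HONEST FRAMING.  A lower bound for ONE datum at the FLAT configuration, top level, whole torus; nothing of Bałaban's asserted; N12 ∕ N10 NOT discharged; K1⁹ NOT closed; count-neutral (typed
28∕28 · discharged 5∕27 unmoved); one finite 𝕋⁴ programme at fixed ε — R4 closes the conditional finite-𝕋⁴ rung `BalabanLadder.UV` only; the YM mass gap (Clay) is NOT proved by any of this;
nothing continuum ∕ ℝ⁴ ∕ OS.
-/

noncomputable section
open scoped BigOperators Matrix.Norms.L2Operator
open Finset
namespace Summit.QuantumFields.YangMills.BalabanUVNodes.N12FlatLinFamilyLetterFloor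

open Literature.MathematicalPhysics.QuantumFieldTheory.Balaban1983to89
open LatticeFieldCalculus (bondAvgIter)
open BlockAveragingEMLLinearised (linAvg)
open B5Eq118OneStroke (iterBlock card_iterBlock)
open Summit.QuantumFields.YangMills.Theorems.ChartHInv (exists_combFamily linFamily_eq_sub_comb)
open Summit.QuantumFields.YangMills.BalabanUVNodes.N12FlatIterGramExact (sum_kernel_iter_mul_eq bondAvgIter_eq_sum_kernel sum_site_eq_sum_iterBlock pow_side)
open Summit.QuantumFields.YangMills.BalabanUVNodes.N12FlatLinAvgLetterFloor (sum_indicator_grad_eq_zero sum_indicator_dir_eq_card sq_re_entry_le_norm_sq sum_norm_sq_dirDatum)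
open Summit.QuantumFields.YangMills.BalabanUVNodes.N12FlatLinFamilyRightInverseUniform (re_bondAvgIter_entry)

variable {P : Params} {n : Type*} [Fintype n] [DecidableEq n] {k : ℕ}

/-! ## §1  The `k`-fold tent kernel against the indicator of one direction; counting -/

omit [Fintype n] [DecidableEq n] in
/-- **`Q_kᵗ𝟙_{dir = μ₀} = M^{−d}·𝟙_{dir = μ₀}`** (`M = L^k`, `k ≤ m + K`): module H9's `k`-fold tent sums the indicator of the coarse `μ₀`-bonds to `(M^{d+1})⁻¹·((o+1) + (M−1−o)) = M^{−d}` on every fine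
`μ₀`-bond (`o` its offset) and to `0` on the others. [cite: Balaban1984PropagatorsI, (1.18) p.20] -/
theorem sum_kernel_iter_indicator_dir [DecidableEq (PBond P 0)] (hk : k ≤ P.m + P.K) (μ₀ : Fin P.d) (b : PBond P 0) :
    ∑ c : PBond P k, bondAvgIter k (Pi.single b (1 : ℝ)) c * (if c.dir = μ₀ then (1 : ℝ) else 0) =
      if b.dir = μ₀ then ((((P.L ^ k : ℕ) : ℝ)) ^ P.d)⁻¹ else 0 := by
  obtain ⟨x, μ⟩ := b
  rw [sum_kernel_iter_mul_eq hk (fun c : PBond P k => if c.dir = μ₀ then (1 : ℝ) else 0) x μ, pow_side P k]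
  have hM : (((P.L ^ k : ℕ) : ℝ)) ≠ 0 := by have := P.L_pos; positivity
  simp only
  split_ifs with h
  · rw [pow_succ]; field_simp; ring
  · ring

omit [Fintype n] [DecidableEq n] in
/-- **`|T^{(0)}| = M^d·|T^{(k)}|`** (`k ≤ m + K`): the fine torus is the disjoint union of the `k`-blocks, each of `(L^d)^k = M^d` sites. [cite: Balaban1984PropagatorsI, (1.18) p.20] -/
theorem card_site_zero_eq_mul (hk : k ≤ P.m + P.K) :
    (Fintype.card (Site P 0) : ℝ) = (((P.L ^ k : ℕ) : ℝ)) ^ P.d * Fintype.card (Site P k) := by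
  have h := sum_site_eq_sum_iterBlock (P := P) (k := k) (fun _ : Site P 0 => (1 : ℝ))
  simp only [Finset.sum_const, Finset.card_univ, nsmul_eq_mul, mul_one] at h
  rw [h, Finset.sum_congr rfl fun y _ => by rw [card_iterBlock k hk y], Finset.sum_const, Finset.card_univ, nsmul_eq_mul]
  push_cast
  rw [← pow_mul, ← pow_mul, Nat.mul_comm P.d k]
  ring

/-! ## §2  The floor -/

/-- ★★★ **THE LETTER OF ANY RIGHT INVERSE OF THE TRUE `k`-FOLD LINEARISATION IS `≥ M^{d−2}` ON THE UNIT DATUM OF ONE DIRECTION** (`k ≤ m + K`, `M = L^k`, any `linAvg`-family `Q`): if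
`Q k Y = 𝟙_{dir = μ₀}·E_{i₀i₀}` then `M^d·|T^{(k)}| ≤ M²·Σ_b ‖Y(b)‖²`.  With `Σ_c ‖v(c)‖² = |T^{(k)}|` (module H12c's `sum_norm_sq_dirDatum`) this is `Σ_b‖Y(b)‖² ≥ M^{d−2}·Σ_c‖v(c)‖²`:
module H13's `k`-uniform letter is of the right order in `M`. [cite: Balaban1985Variational, (44)-(46) p.285; Balaban1985Averaging, (124)-(125) p.36, (62) p.28; Balaban1984PropagatorsI, (1.18) p.20] -/
theorem letter_floor_linFamily_dir
    (Q : (i : ℕ) → (PBond P 0 → Matrix n n ℂ) → PBond P i → Matrix n n ℂ)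
    (hQ0 : ∀ Y, Q 0 Y = Y) (hQs : ∀ (i : ℕ) (Y : PBond P 0 → Matrix n n ℂ) (c : PBond P (i + 1)), Q (i + 1) Y c = linAvg (Q i Y) c)
    (hk : k ≤ P.m + P.K) (μ₀ : Fin P.d) (i₀ : n) (Y : PBond P 0 → Matrix n n ℂ)
    (hY : ∀ c : PBond P k, Q k Y c = if c.dir = μ₀ then Matrix.single i₀ i₀ (1 : ℂ) else 0) :
    (((P.L ^ k : ℕ) : ℝ)) ^ P.d * Fintype.card (Site P k) ≤ (((P.L ^ k : ℕ) : ℝ)) ^ 2 * ∑ b, ‖Y b‖ ^ 2 := by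
  classical
  obtain ⟨Λ, hΛ0, hΛs⟩ := exists_combFamily (P := P) (n := n)
  have hM : (0 : ℝ) < ((P.L ^ k : ℕ) : ℝ) := by have := P.L_pos; positivity
  have hMd : (0 : ℝ) < (((P.L ^ k : ℕ) : ℝ)) ^ P.d := by positivity
  -- the indicator, the real component
  set w : PBond P k → ℝ := fun c => if c.dir = μ₀ then (1 : ℝ) else 0 with hw
  set a : PBond P 0 → ℝ := fun b => (Y b i₀ i₀).re with ha
  -- Step 1: the real `(i₀,i₀)` component of `Q k Y = M•Q_kY − dΛ_k(Y)` at the datum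
  have hstep1 : ∀ c : PBond P k, ((P.L ^ k : ℕ) : ℝ) * bondAvgIter k a c - (((Λ k Y c.tgt) i₀ i₀).re - ((Λ k Y c.src) i₀ i₀).re) = w c := by
    intro c
    have h := hY c
    rw [linFamily_eq_sub_comb Q hQ0 hQs Λ hΛ0 hΛs Y k c, ← Nat.cast_smul_eq_nsmul ℂ] at h
    have h2 := congrArg (fun A : Matrix n n ℂ => (A i₀ i₀).re) h
    simp only [Matrix.sub_apply, Matrix.smul_apply, smul_eq_mul, Complex.sub_re, Complex.mul_re, Complex.natCast_re, Complex.natCast_im, zero_mul, sub_zero,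
      re_bondAvgIter_entry] at h2
    rw [h2]
    by_cases hc : c.dir = μ₀
    · simp [hw, hc, Matrix.single_apply_same]
    · simp [hw, hc]
  -- Step 2: pair with the indicator
  have hstep2 : ∑ c, w c * (((P.L ^ k : ℕ) : ℝ) * bondAvgIter k a c - (((Λ k Y c.tgt) i₀ i₀).re - ((Λ k Y c.src) i₀ i₀).re)) = Fintype.card (Site P k) := by
    have h1 : ∀ c, w c * (((P.L ^ k : ℕ) : ℝ) * bondAvgIter k a c - (((Λ k Y c.tgt) i₀ i₀).re - ((Λ k Y c.src) i₀ i₀).re)) = w c := fun c => by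
      rw [hstep1 c]
      by_cases hc : c.dir = μ₀ <;> simp [hw, hc]
    simp only [h1]
    exact sum_indicator_dir_eq_card μ₀
  -- Step 3: the comb term telescopes, the straight term is the transpose kernel
  have hcomb : ∑ c, w c * (((Λ k Y c.tgt) i₀ i₀).re - ((Λ k Y c.src) i₀ i₀).re) = 0 :=
    sum_indicator_grad_eq_zero μ₀ (fun y => ((Λ k Y y) i₀ i₀).re)
  have hstraight : ∑ c, w c * (((P.L ^ k : ℕ) : ℝ) * bondAvgIter k a c) =
      ((P.L ^ k : ℕ) : ℝ) * (((((P.L ^ k : ℕ) : ℝ)) ^ P.d)⁻¹ * ∑ b, (if b.dir = μ₀ then (1 : ℝ) else 0) * a b) := by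
    have h1 : ∀ c, w c * (((P.L ^ k : ℕ) : ℝ) * bondAvgIter k a c) = ((P.L ^ k : ℕ) : ℝ) * ∑ b, bondAvgIter k (Pi.single b (1 : ℝ)) c * w c * a b := fun c => by
      rw [bondAvgIter_eq_sum_kernel a c, Finset.mul_sum, Finset.mul_sum, Finset.mul_sum]
      exact Finset.sum_congr rfl fun b _ => by ring
    simp only [h1, ← Finset.mul_sum]
    congr 1
    rw [Finset.sum_comm]
    have h2 : ∀ b : PBond P 0, ∑ c, bondAvgIter k (Pi.single b (1 : ℝ)) c * w c * a b = (if b.dir = μ₀ then ((((P.L ^ k : ℕ) : ℝ)) ^ P.d)⁻¹ else 0) * a b := fun b => by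
      rw [← Finset.sum_mul, sum_kernel_iter_indicator_dir hk μ₀ b]
    simp only [h2, Finset.mul_sum]
    exact Finset.sum_congr rfl fun b _ => by split_ifs <;> ring
  -- Step 4: `|T^{(k)}| = M^{1−d}·S`, `S = Σ_{dir b = μ₀} a b`
  set S : ℝ := ∑ b, (if b.dir = μ₀ then (1 : ℝ) else 0) * a b with hS
  have hcardS : (Fintype.card (Site P k) : ℝ) = ((P.L ^ k : ℕ) : ℝ) * (((((P.L ^ k : ℕ) : ℝ)) ^ P.d)⁻¹ * S) := by
    rw [← hstep2]
    have : ∀ c, w c * (((P.L ^ k : ℕ) : ℝ) * bondAvgIter k a c - (((Λ k Y c.tgt) i₀ i₀).re - ((Λ k Y c.src) i₀ i₀).re)) =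
        w c * (((P.L ^ k : ℕ) : ℝ) * bondAvgIter k a c) - w c * (((Λ k Y c.tgt) i₀ i₀).re - ((Λ k Y c.src) i₀ i₀).re) := fun c => by ring
    simp only [this, Finset.sum_sub_distrib, hcomb, sub_zero]
    exact hstraight
  -- Step 5: Cauchy–Schwarz `S² ≤ (#μ₀-bonds)·Σ a² = M^d|T^{(k)}|·Σ a² ≤ M^d|T^{(k)}|·Σ‖Y‖²`
  have hCS : S ^ 2 ≤ (∑ b : PBond P 0, (if b.dir = μ₀ then (1 : ℝ) else 0) ^ 2) * ∑ b, a b ^ 2 := Finset.sum_mul_sq_le_sq_mul_sq _ _ _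
  have hind : ∑ b : PBond P 0, (if b.dir = μ₀ then (1 : ℝ) else 0) ^ 2 = (((P.L ^ k : ℕ) : ℝ)) ^ P.d * Fintype.card (Site P k) := by
    have h1 : ∀ b : PBond P 0, (if b.dir = μ₀ then (1 : ℝ) else 0) ^ 2 = if b.dir = μ₀ then (1 : ℝ) else 0 := fun b => by split_ifs <;> simp
    simp only [h1]
    rw [sum_indicator_dir_eq_card μ₀, card_site_zero_eq_mul hk]
  have ha2 : ∑ b, a b ^ 2 ≤ ∑ b, ‖Y b‖ ^ 2 := Finset.sum_le_sum fun b _ => sq_re_entry_le_norm_sq (Y b) i₀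
  -- assemble
  set C : ℝ := (Fintype.card (Site P k) : ℝ) with hC
  set T : ℝ := ∑ b, ‖Y b‖ ^ 2 with hT
  have hC0 : 0 < C := by rw [hC]; exact_mod_cast Fintype.card_pos
  have hT0 : 0 ≤ T := Finset.sum_nonneg fun b _ => sq_nonneg _
  have hS_eq : S = ((((P.L ^ k : ℕ) : ℝ)) ^ P.d) * C / ((P.L ^ k : ℕ) : ℝ) := by
    rw [hcardS]; field_simp
  have h1 : S ^ 2 ≤ ((((P.L ^ k : ℕ) : ℝ)) ^ P.d * C) * T := hCS.trans (by rw [hind]; exact mul_le_mul_of_nonneg_left ha2 (by positivity))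
  rw [hS_eq] at h1
  -- `(M^d C / M)² ≤ M^d C T` ⇒ `M^d C ≤ M² T`
  have h2 : ((((P.L ^ k : ℕ) : ℝ)) ^ P.d * C) * ((((P.L ^ k : ℕ) : ℝ)) ^ P.d * C) ≤ ((((P.L ^ k : ℕ) : ℝ)) ^ P.d * C) * ((((P.L ^ k : ℕ) : ℝ)) ^ 2 * T) := by
    have h3 : ((((P.L ^ k : ℕ) : ℝ)) ^ P.d * C / ((P.L ^ k : ℕ) : ℝ)) ^ 2 * (((P.L ^ k : ℕ) : ℝ)) ^ 2 =
        ((((P.L ^ k : ℕ) : ℝ)) ^ P.d * C) * ((((P.L ^ k : ℕ) : ℝ)) ^ P.d * C) := by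
      field_simp
    nlinarith [h1, sq_nonneg (((P.L ^ k : ℕ) : ℝ))]
  exact le_of_mul_le_mul_left h2 (by positivity)

/-- ★★ **EVERY RIGHT INVERSE `R` OF `Q k` COSTS AT LEAST `M^{d−2}` AT THE DATUM `v₀ = 𝟙_{dir = μ₀}·E_{i₀i₀}`**: `M^d·Σ_c ‖v₀(c)‖² ≤ M²·Σ_b ‖(R v₀)(b)‖²` — the companion of module H13's
`exists_linFamily_rightInverse_uniform` (letter `≤ |n|(6M^d∕(M²+2) + 1152d(d+2)²)·Σ‖v‖²`, of the same order `M^{d−2}`). [cite: Balaban1985Variational, (44)-(46) p.285; Balaban1985Averaging, (124)-(125) p.36] -/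
theorem letter_floor_linFamily_rightInverse
    (Q : (i : ℕ) → (PBond P 0 → Matrix n n ℂ) → PBond P i → Matrix n n ℂ)
    (hQ0 : ∀ Y, Q 0 Y = Y) (hQs : ∀ (i : ℕ) (Y : PBond P 0 → Matrix n n ℂ) (c : PBond P (i + 1)), Q (i + 1) Y c = linAvg (Q i Y) c)
    (hk : k ≤ P.m + P.K) (R : (PBond P k → Matrix n n ℂ) → (PBond P 0 → Matrix n n ℂ)) (hR : ∀ v c, Q k (R v) c = v c) (μ₀ : Fin P.d) (i₀ : n) :
    (((P.L ^ k : ℕ) : ℝ)) ^ P.d * ∑ c : PBond P k, ‖(if c.dir = μ₀ then Matrix.single i₀ i₀ (1 : ℂ) else (0 : Matrix n n ℂ))‖ ^ 2 ≤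
      (((P.L ^ k : ℕ) : ℝ)) ^ 2 * ∑ b, ‖R (fun c => if c.dir = μ₀ then Matrix.single i₀ i₀ (1 : ℂ) else 0) b‖ ^ 2 := by
  rw [sum_norm_sq_dirDatum μ₀ i₀]
  exact letter_floor_linFamily_dir Q hQ0 hQs hk μ₀ i₀ _ fun c => hR _ c

end Summit.QuantumFields.YangMills.BalabanUVNodes.N12FlatLinFamilyLetterFloor

end
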